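import Mathlib.Data.Matrix.Block
import Mathlib.Algebra.Ring.Invertible
import Mathlib.Tactic.Abel
import Mathlib.Tactic.Ring
import HarnessLib

/-!
# `Δ`-adapted block coordinates on the doubled unitary group `U(𝕍 ⊕ −𝕍)`
# ([Kudla1994, §3]; [HarrisKudlaSweet1996, §1 (1.11)])

Topic `NumberTheory/GelbartRogawski1991`; namespace `Literature.NumberTheory.GelbartRogawski1991.AdaptedBlocks`.
KERNEL ONLY: definitions with bodies and proved lemmas over an arbitrary commutative ring `L` with `2`
invertible; no named fact, no `sorry`.

For the doubled hermitian space `𝔻 = 𝕍 ⊕ (−𝕍)` (Gram matrix `J = T ⊕ (−T)` on `ι ⊕ ι`) the polarisation by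
the two maximal isotropic subspaces `Δ = {(u, u)}` and `Δ⁻ = {(u, −u)}` is the frame in which Kudla's splitting of
the metaplectic cocycle over `U(𝔻)` is computed ([Kudla1994, §3]: the Siegel parabolic `P = P_Δ`, its opposite, the
invariant `x(g)`; [HarrisKudlaSweet1996, §1 (1.11)–(1.15)]).  This file is the dictionary between the
`(𝕍, −𝕍)`-blocks `M₁₁, M₁₂, M₂₁, M₂₂` of a matrix `M` on `ι ⊕ ι` and its `(Δ, Δ⁻)`-ADAPTED blocks

  `A = ½(M₁₁+M₁₂+M₂₁+M₂₂)` (`Δ → Δ`),  `B = ½(M₁₁−M₁₂+M₂₁−M₂₂)` (`Δ⁻ → Δ`),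
  `C = ½(M₁₁+M₁₂−M₂₁−M₂₂)` (`Δ → Δ⁻`), `D = ½(M₁₁−M₁₂−M₂₁+M₂₂)` (`Δ⁻ → Δ⁻`)

(`blkA`, `blkB`, `blkC`, `blkD`; `adapt M = R⁻¹ M R = [[A, B], [C, D]]` for the change of basis
`R = [[1, 1], [1, −1]]`, `adapt_eq`):

* §1 diagonal ∕ anti-diagonal vectors `dblV a = (a, a)`, `adblV b = (b, −b)`, the decomposition
  `u = dblV (½(u_L + u_R)) + adblV (½(u_L − u_R))` and its uniqueness;
* §2 the adapted blocks, `adapt (M N) = adapt M · adapt N` and the resulting product rules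
  (`blkA_mul : A(MN) = A A' + B C'`, `blkC_mul : C(MN) = C A' + D C'`, …), the action on vectors
  `M (dblV z) = dblV (A z) + adblV (C z)`, `M (adblV y) = dblV (B y) + adblV (D y)`;
* (sequel `DoubledUnitaryAdaptedRelations`: §3 the hermitian form of `J = T ⊕ (−T)` in the adapted frame,
  `h(dblV a + adblV b, dblV a' + adblV b') = 2 (aᴴ T b' + bᴴ T a')`, and §4 the unitarity relations of
  `g ∈ U(σ, J)` in adapted blocks, `Cᴴ T A + Aᴴ T C = 0`, `Cᴴ T B + Aᴴ T D = T`, ….)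

The Siegel parabolic is `C = 0` (then `A = M₁₁ + M₁₂`, cf. `IsSiegelReindex` ∕ `deltaBlock` of the tree), the big
cell `P_Δ w P_Δ` is `C invertible`.  Consumers: the GR-1 local package (Kudla's splitting function
`g ↦ χ(det C(g))` on the big cell and the left-genericity of the big cell).

Written for the kernel construction of [GelbartRogawski1991, Prop. 3.1.1] behind the cited input `hGRU` of the
Hodge-CM period-theorem package (stage-1 cell `pub-hodgecm`, seat GR-1, 2026-08-21); nothing here is a claim of the
manuscripts adjudicated by that cell.

## References

* S. S. Kudla, Israel J. Math. 87 (1994) 361–401, §3 [Kudla1994].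
* M. Harris, S. S. Kudla, W. J. Sweet, J. Amer. Math. Soc. 9 (1996) 941–1004, §1 (1.11)–(1.15) [HarrisKudlaSweet1996].
-/

set_option autoImplicit false

open Matrix

namespace Literature.NumberTheory.GelbartRogawski1991.AdaptedBlocks

variable {L : Type*} [CommRing L] {ι : Type*}

/-! ## §1 Diagonal and anti-diagonal vectors -/

/-- the `Δ`-vector `(a, a)` of `L^ι ⊕ L^ι`. [cite: HarrisKudlaSweet1996, §1 (1.11)] -/
def dblV (a : ι → L) : ι ⊕ ι → L := Sum.elim a a

/-- the `Δ⁻`-vector `(b, −b)`. [cite: HarrisKudlaSweet1996, §1 (1.11)] -/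
def adblV (b : ι → L) : ι ⊕ ι → L := Sum.elim b (-b)

/-- `dblV a + adblV b = (a + b, a − b)`. [cite: HarrisKudlaSweet1996, §1 (1.11)] -/
theorem dblV_add_adblV (a b : ι → L) : dblV a + adblV b = Sum.elim (a + b) (a - b) := by
  funext k
  rcases k with i | i
  · simp [dblV, adblV]
  · simp [dblV, adblV, sub_eq_add_neg]

/-- `dblV` is additive. [cite: HarrisKudlaSweet1996, §1 (1.11)] -/
theorem dblV_add (a a' : ι → L) : dblV (a + a') = dblV a + dblV a' := by
  funext k; rcases k with i | i <;> simp [dblV]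

/-- `adblV` is additive. [cite: HarrisKudlaSweet1996, §1 (1.11)] -/
theorem adblV_add (b b' : ι → L) : adblV (b + b') = adblV b + adblV b' := by
  funext k; rcases k with i | i <;> simp [adblV, add_comm]

/-- `dblV` commutes with scalars. [cite: HarrisKudlaSweet1996, §1 (1.11)] -/
theorem dblV_smul (c : L) (a : ι → L) : dblV (c • a) = c • dblV a := by
  funext k; rcases k with i | i <;> simp [dblV]

/-- `adblV` commutes with scalars. [cite: HarrisKudlaSweet1996, §1 (1.11)] -/
theorem adblV_smul (c : L) (b : ι → L) : adblV (c • b) = c • adblV b := by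
  funext k; rcases k with i | i <;> simp [adblV]

/-- `dblV 0 = 0`. [cite: HarrisKudlaSweet1996, §1 (1.11)] -/
@[simp] theorem dblV_zero : dblV (0 : ι → L) = 0 := by
  funext k; rcases k with i | i <;> simp [dblV]

/-- `adblV 0 = 0`. [cite: HarrisKudlaSweet1996, §1 (1.11)] -/
@[simp] theorem adblV_zero : adblV (0 : ι → L) = 0 := by
  funext k; rcases k with i | i <;> simp [adblV]

section Half

variable [Invertible (2 : L)]

/-- the `Δ`-component `½(u_L + u_R)` of `u`. [cite: HarrisKudlaSweet1996, §1 (1.11)] -/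
def halfSum (u : ι ⊕ ι → L) : ι → L := ⅟(2 : L) • (u ∘ Sum.inl + u ∘ Sum.inr)

/-- the `Δ⁻`-component `½(u_L − u_R)` of `u`. [cite: HarrisKudlaSweet1996, §1 (1.11)] -/
def halfDiff (u : ι ⊕ ι → L) : ι → L := ⅟(2 : L) • (u ∘ Sum.inl - u ∘ Sum.inr)

/-- **`u = dblV (½(u_L + u_R)) + adblV (½(u_L − u_R))`**: `L^ι ⊕ L^ι = Δ ⊕ Δ⁻`. [cite: HarrisKudlaSweet1996, §1 (1.11)] -/
theorem dblV_halfSum_add_adblV_halfDiff (u : ι ⊕ ι → L) : dblV (halfSum u) + adblV (halfDiff u) = u := by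
  funext k
  rcases k with i | i
  · simp only [Pi.add_apply, dblV, adblV, Sum.elim_inl, halfSum, halfDiff, Pi.smul_apply, Pi.sub_apply,
      Function.comp_apply, smul_eq_mul]
    rw [← mul_add, show u (Sum.inl i) + u (Sum.inr i) + (u (Sum.inl i) - u (Sum.inr i)) = 2 * u (Sum.inl i) by ring,
      ← mul_assoc, invOf_mul_self, one_mul]
  · simp only [Pi.add_apply, dblV, adblV, Sum.elim_inr, halfSum, halfDiff, Pi.smul_apply, Pi.sub_apply,
      Pi.neg_apply, Function.comp_apply, smul_eq_mul]
    rw [← mul_neg, ← mul_add,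
      show u (Sum.inl i) + u (Sum.inr i) + -(u (Sum.inl i) - u (Sum.inr i)) = 2 * u (Sum.inr i) by ring,
      ← mul_assoc, invOf_mul_self, one_mul]

/-- the `Δ`-component of `dblV a + adblV b` is `a`. [cite: HarrisKudlaSweet1996, §1 (1.11)] -/
theorem halfSum_dblV_add_adblV (a b : ι → L) : halfSum (dblV a + adblV b) = a := by
  funext i
  simp only [halfSum, Pi.smul_apply, Pi.add_apply, Function.comp_apply, dblV, adblV, Sum.elim_inl, Sum.elim_inr,
    Pi.neg_apply, smul_eq_mul]
  rw [show a i + b i + (a i + -b i) = 2 * a i by ring, ← mul_assoc, invOf_mul_self, one_mul]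

/-- the `Δ⁻`-component of `dblV a + adblV b` is `b`. [cite: HarrisKudlaSweet1996, §1 (1.11)] -/
theorem halfDiff_dblV_add_adblV (a b : ι → L) : halfDiff (dblV a + adblV b) = b := by
  funext i
  simp only [halfDiff, Pi.smul_apply, Pi.add_apply, Pi.sub_apply, Function.comp_apply, dblV, adblV, Sum.elim_inl,
    Sum.elim_inr, Pi.neg_apply, smul_eq_mul]
  rw [show a i + b i - (a i + -b i) = 2 * b i by ring, ← mul_assoc, invOf_mul_self, one_mul]

/-- **uniqueness of the decomposition along `Δ ⊕ Δ⁻`**. [cite: HarrisKudlaSweet1996, §1 (1.11)] -/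
theorem dblV_add_adblV_inj {a b a' b' : ι → L} (h : dblV a + adblV b = dblV a' + adblV b') : a = a' ∧ b = b' := by
  constructor
  · rw [← halfSum_dblV_add_adblV a b, h, halfSum_dblV_add_adblV]
  · rw [← halfDiff_dblV_add_adblV a b, h, halfDiff_dblV_add_adblV]

/-- `halfSum (dblV a) = a`. [cite: HarrisKudlaSweet1996, §1 (1.11)] -/
@[simp] theorem halfSum_dblV (a : ι → L) : halfSum (dblV a) = a := by
  simpa using halfSum_dblV_add_adblV a 0

/-- `halfDiff (dblV a) = 0`. [cite: HarrisKudlaSweet1996, §1 (1.11)] -/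
@[simp] theorem halfDiff_dblV (a : ι → L) : halfDiff (dblV a) = 0 := by
  simpa using halfDiff_dblV_add_adblV a 0

/-- `halfSum (adblV b) = 0`. [cite: HarrisKudlaSweet1996, §1 (1.11)] -/
@[simp] theorem halfSum_adblV (b : ι → L) : halfSum (adblV b) = 0 := by
  simpa using halfSum_dblV_add_adblV 0 b

/-- `halfDiff (adblV b) = b`. [cite: HarrisKudlaSweet1996, §1 (1.11)] -/
@[simp] theorem halfDiff_adblV (b : ι → L) : halfDiff (adblV b) = b := by
  simpa using halfDiff_dblV_add_adblV 0 b

/-- `halfSum` is additive. [cite: HarrisKudlaSweet1996, §1 (1.11)] -/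
theorem halfSum_add (u u' : ι ⊕ ι → L) : halfSum (u + u') = halfSum u + halfSum u' := by
  funext i; simp only [halfSum, Pi.smul_apply, Pi.add_apply, Function.comp_apply, smul_eq_mul]; ring

/-- `halfDiff` is additive. [cite: HarrisKudlaSweet1996, §1 (1.11)] -/
theorem halfDiff_add (u u' : ι ⊕ ι → L) : halfDiff (u + u') = halfDiff u + halfDiff u' := by
  funext i; simp only [halfDiff, Pi.smul_apply, Pi.add_apply, Pi.sub_apply, Function.comp_apply, smul_eq_mul]; ring

end Half

/-! ## §2 The adapted blocks -/

section Blocks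

variable [Fintype ι] [DecidableEq ι] [Invertible (2 : L)]

/-- `A = ½(M₁₁+M₁₂+M₂₁+M₂₂)`, the `Δ → Δ` block. [cite: Kudla1994, §3] -/
def blkA (M : Matrix (ι ⊕ ι) (ι ⊕ ι) L) : Matrix ι ι L :=
  ⅟(2 : L) • (M.toBlocks₁₁ + M.toBlocks₁₂ + M.toBlocks₂₁ + M.toBlocks₂₂)

/-- `B = ½(M₁₁−M₁₂+M₂₁−M₂₂)`, the `Δ⁻ → Δ` block. [cite: Kudla1994, §3] -/
def blkB (M : Matrix (ι ⊕ ι) (ι ⊕ ι) L) : Matrix ι ι L :=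
  ⅟(2 : L) • (M.toBlocks₁₁ - M.toBlocks₁₂ + M.toBlocks₂₁ - M.toBlocks₂₂)

/-- `C = ½(M₁₁+M₁₂−M₂₁−M₂₂)`, the `Δ → Δ⁻` block (Kudla's `c`-block: `P_Δ = {C = 0}`, big cell `= {C invertible}`).
[cite: Kudla1994, §3] -/
def blkC (M : Matrix (ι ⊕ ι) (ι ⊕ ι) L) : Matrix ι ι L :=
  ⅟(2 : L) • (M.toBlocks₁₁ + M.toBlocks₁₂ - M.toBlocks₂₁ - M.toBlocks₂₂)

/-- `D = ½(M₁₁−M₁₂−M₂₁+M₂₂)`, the `Δ⁻ → Δ⁻` block. [cite: Kudla1994, §3] -/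
def blkD (M : Matrix (ι ⊕ ι) (ι ⊕ ι) L) : Matrix ι ι L :=
  ⅟(2 : L) • (M.toBlocks₁₁ - M.toBlocks₁₂ - M.toBlocks₂₁ + M.toBlocks₂₂)

variable (L ι) in
/-- the change of basis `R = [[1, 1], [1, −1]]` from the adapted frame `(Δ, Δ⁻)` to `(𝕍, −𝕍)` (`R (a; b) = (a + b, a − b)
= dblV a + adblV b`). [cite: HarrisKudlaSweet1996, §1 (1.11)] -/
def cayR : Matrix (ι ⊕ ι) (ι ⊕ ι) L := Matrix.fromBlocks 1 1 1 (-1)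

variable (L ι) in
/-- `R⁻¹ = ½ R`. [cite: HarrisKudlaSweet1996, §1 (1.11)] -/
def cayRinv : Matrix (ι ⊕ ι) (ι ⊕ ι) L := ⅟(2 : L) • cayR L ι

omit [Invertible (2 : L)] in
/-- `R² = 2`. [cite: HarrisKudlaSweet1996, §1 (1.11)] -/
theorem cayR_mul_cayR : cayR L ι * cayR L ι = (2 : L) • (1 : Matrix (ι ⊕ ι) (ι ⊕ ι) L) := by
  rw [cayR, Matrix.fromBlocks_multiply, ← Matrix.fromBlocks_one, Matrix.fromBlocks_smul, two_smul]
  simp only [Matrix.mul_one, Matrix.mul_neg, neg_neg, smul_zero]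
  congr 1 <;> abel

/-- `R · R⁻¹ = 1`. [cite: HarrisKudlaSweet1996, §1 (1.11)] -/
theorem cayR_mul_cayRinv : cayR L ι * cayRinv L ι = 1 := by
  rw [cayRinv, Matrix.mul_smul, cayR_mul_cayR, smul_smul, invOf_mul_self, one_smul]

/-- `R⁻¹ · R = 1`. [cite: HarrisKudlaSweet1996, §1 (1.11)] -/
theorem cayRinv_mul_cayR : cayRinv L ι * cayR L ι = 1 := by
  rw [cayRinv, Matrix.smul_mul, cayR_mul_cayR, smul_smul, invOf_mul_self, one_smul]

/-- **the matrix in the adapted frame**: `adapt M = R⁻¹ M R`. [cite: Kudla1994, §3] -/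
def adapt (M : Matrix (ι ⊕ ι) (ι ⊕ ι) L) : Matrix (ι ⊕ ι) (ι ⊕ ι) L := cayRinv L ι * M * cayR L ι

/-- **`R⁻¹ M R = [[A, B], [C, D]]`**. [cite: Kudla1994, §3] -/
theorem adapt_eq (M : Matrix (ι ⊕ ι) (ι ⊕ ι) L) :
    adapt M = Matrix.fromBlocks (blkA M) (blkB M) (blkC M) (blkD M) := by
  rw [adapt, cayRinv, cayR, Matrix.smul_mul, Matrix.smul_mul, ← Matrix.fromBlocks_toBlocks M,
    Matrix.fromBlocks_multiply, Matrix.fromBlocks_multiply, Matrix.fromBlocks_smul]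
  simp only [Matrix.toBlocks_fromBlocks₁₁, Matrix.toBlocks_fromBlocks₁₂, Matrix.toBlocks_fromBlocks₂₁,
    Matrix.toBlocks_fromBlocks₂₂, Matrix.one_mul, Matrix.mul_one, Matrix.neg_mul, Matrix.mul_neg,
    blkA, blkB, blkC, blkD]
  congr 1 <;> · congr 1; abel

/-- `adapt` is multiplicative. [cite: HarrisKudlaSweet1996, §1 (1.11)] -/
theorem adapt_mul (M N : Matrix (ι ⊕ ι) (ι ⊕ ι) L) : adapt (M * N) = adapt M * adapt N := by
  simp only [adapt, Matrix.mul_assoc]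
  rw [← Matrix.mul_assoc (cayR L ι) (cayRinv L ι), cayR_mul_cayRinv, Matrix.one_mul]

/-- `adapt 1 = 1`. [cite: HarrisKudlaSweet1996, §1 (1.11)] -/
theorem adapt_one : adapt (1 : Matrix (ι ⊕ ι) (ι ⊕ ι) L) = 1 := by
  rw [adapt, Matrix.mul_one, cayRinv_mul_cayR]

/-- `M ↦ adapt M` is injective (`M = R (adapt M) R⁻¹`). [cite: HarrisKudlaSweet1996, §1 (1.11)] -/
theorem eq_of_adapt_eq {M N : Matrix (ι ⊕ ι) (ι ⊕ ι) L} (h : adapt M = adapt N) : M = N := by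
  have key : ∀ X : Matrix (ι ⊕ ι) (ι ⊕ ι) L, cayR L ι * adapt X * cayRinv L ι = X := fun X => by
    rw [adapt, ← Matrix.mul_assoc, ← Matrix.mul_assoc, cayR_mul_cayRinv, Matrix.one_mul, Matrix.mul_assoc,
      cayR_mul_cayRinv, Matrix.mul_one]
  rw [← key M, h, key N]

/-- the product rules of the adapted blocks. [cite: HarrisKudlaSweet1996, §1 (1.11)] -/
private theorem blocks_mul (M N : Matrix (ι ⊕ ι) (ι ⊕ ι) L) :
    blkA (M * N) = blkA M * blkA N + blkB M * blkC N ∧ blkB (M * N) = blkA M * blkB N + blkB M * blkD N ∧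
      blkC (M * N) = blkC M * blkA N + blkD M * blkC N ∧ blkD (M * N) = blkC M * blkB N + blkD M * blkD N := by
  have h := adapt_mul M N
  rw [adapt_eq, adapt_eq, adapt_eq, Matrix.fromBlocks_multiply] at h
  obtain ⟨h₁, h₂, h₃, h₄⟩ := Matrix.fromBlocks_inj.1 h
  exact ⟨h₁, h₂, h₃, h₄⟩

/-- **`A(MN) = A A' + B C'`**. [cite: Kudla1994, §3] -/
theorem blkA_mul (M N : Matrix (ι ⊕ ι) (ι ⊕ ι) L) : blkA (M * N) = blkA M * blkA N + blkB M * blkC N :=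
  (blocks_mul M N).1

/-- `B(MN) = A B' + B D'`. [cite: Kudla1994, §3] -/
theorem blkB_mul (M N : Matrix (ι ⊕ ι) (ι ⊕ ι) L) : blkB (M * N) = blkA M * blkB N + blkB M * blkD N :=
  (blocks_mul M N).2.1

/-- **`C(MN) = C A' + D C'`**. [cite: Kudla1994, §3] -/
theorem blkC_mul (M N : Matrix (ι ⊕ ι) (ι ⊕ ι) L) : blkC (M * N) = blkC M * blkA N + blkD M * blkC N :=
  (blocks_mul M N).2.2.1

/-- `D(MN) = C B' + D D'`. [cite: Kudla1994, §3] -/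
theorem blkD_mul (M N : Matrix (ι ⊕ ι) (ι ⊕ ι) L) : blkD (M * N) = blkC M * blkB N + blkD M * blkD N :=
  (blocks_mul M N).2.2.2

/-- the adapted blocks of `1`. [cite: HarrisKudlaSweet1996, §1 (1.11)] -/
private theorem blocks_one :
    blkA (1 : Matrix (ι ⊕ ι) (ι ⊕ ι) L) = 1 ∧ blkB (1 : Matrix (ι ⊕ ι) (ι ⊕ ι) L) = 0 ∧
      blkC (1 : Matrix (ι ⊕ ι) (ι ⊕ ι) L) = 0 ∧ blkD (1 : Matrix (ι ⊕ ι) (ι ⊕ ι) L) = 1 := by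
  have h : Matrix.fromBlocks (blkA (1 : Matrix (ι ⊕ ι) (ι ⊕ ι) L)) (blkB 1) (blkC 1) (blkD 1) =
      Matrix.fromBlocks 1 0 0 1 := by
    rw [← adapt_eq, adapt_one, Matrix.fromBlocks_one]
  obtain ⟨h₁, h₂, h₃, h₄⟩ := Matrix.fromBlocks_inj.1 h
  exact ⟨h₁, h₂, h₃, h₄⟩

/-- `A(1) = 1`. [cite: HarrisKudlaSweet1996, §1 (1.11)] -/
@[simp] theorem blkA_one : blkA (1 : Matrix (ι ⊕ ι) (ι ⊕ ι) L) = 1 := blocks_one.1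

/-- `B(1) = 0`. [cite: HarrisKudlaSweet1996, §1 (1.11)] -/
@[simp] theorem blkB_one : blkB (1 : Matrix (ι ⊕ ι) (ι ⊕ ι) L) = 0 := blocks_one.2.1

/-- `C(1) = 0`. [cite: HarrisKudlaSweet1996, §1 (1.11)] -/
@[simp] theorem blkC_one : blkC (1 : Matrix (ι ⊕ ι) (ι ⊕ ι) L) = 0 := blocks_one.2.2.1

/-- `D(1) = 1`. [cite: HarrisKudlaSweet1996, §1 (1.11)] -/
@[simp] theorem blkD_one : blkD (1 : Matrix (ι ⊕ ι) (ι ⊕ ι) L) = 1 := blocks_one.2.2.2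

omit [Fintype ι] [DecidableEq ι] in
/-- `A + C = M₁₁ + M₁₂`, `A − C = M₂₁ + M₂₂`, `B + D = M₁₁ − M₁₂`, `B − D = M₂₁ − M₂₂`. [cite: HarrisKudlaSweet1996, §1 (1.11)] -/
private theorem blocks_add_sub (M : Matrix (ι ⊕ ι) (ι ⊕ ι) L) :
    blkA M + blkC M = M.toBlocks₁₁ + M.toBlocks₁₂ ∧ blkA M - blkC M = M.toBlocks₂₁ + M.toBlocks₂₂ ∧
      blkB M + blkD M = M.toBlocks₁₁ - M.toBlocks₁₂ ∧ blkB M - blkD M = M.toBlocks₂₁ - M.toBlocks₂₂ := by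
  have key : ∀ X Y : Matrix ι ι L, X = Y + Y → ⅟(2 : L) • X = Y := fun X Y h => by
    rw [h, ← two_smul L Y, smul_smul, invOf_mul_self, one_smul]
  refine ⟨?_, ?_, ?_, ?_⟩
  · rw [blkA, blkC, ← smul_add]; apply key; abel
  · rw [blkA, blkC, ← smul_sub]; apply key; abel
  · rw [blkB, blkD, ← smul_add]; apply key; abel
  · rw [blkB, blkD, ← smul_sub]; apply key; abel

omit [Fintype ι] [DecidableEq ι] in
/-- `A + C = M₁₁ + M₁₂` (on `P_Δ = {C = 0}` this is the tree's `deltaBlock`). [cite: Kudla1994, §3] -/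
theorem blkA_add_blkC (M : Matrix (ι ⊕ ι) (ι ⊕ ι) L) : blkA M + blkC M = M.toBlocks₁₁ + M.toBlocks₁₂ :=
  (blocks_add_sub M).1

omit [Fintype ι] [DecidableEq ι] in
/-- `A − C = M₂₁ + M₂₂`. [cite: Kudla1994, §3] -/
theorem blkA_sub_blkC (M : Matrix (ι ⊕ ι) (ι ⊕ ι) L) : blkA M - blkC M = M.toBlocks₂₁ + M.toBlocks₂₂ :=
  (blocks_add_sub M).2.1

omit [Fintype ι] [DecidableEq ι] in
/-- `B + D = M₁₁ − M₁₂`. [cite: HarrisKudlaSweet1996, §1 (1.11)] -/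
theorem blkB_add_blkD (M : Matrix (ι ⊕ ι) (ι ⊕ ι) L) : blkB M + blkD M = M.toBlocks₁₁ - M.toBlocks₁₂ :=
  (blocks_add_sub M).2.2.1

omit [Fintype ι] [DecidableEq ι] in
/-- `B − D = M₂₁ − M₂₂`. [cite: HarrisKudlaSweet1996, §1 (1.11)] -/
theorem blkB_sub_blkD (M : Matrix (ι ⊕ ι) (ι ⊕ ι) L) : blkB M - blkD M = M.toBlocks₂₁ - M.toBlocks₂₂ :=
  (blocks_add_sub M).2.2.2

omit [Fintype ι] [DecidableEq ι] in
/-- **`C = 0 ↔ M₁₁ + M₁₂ = M₂₁ + M₂₂`**: the Siegel parabolic `P_Δ` in adapted blocks is the tree's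
`IsSiegelSum` ∕ `IsSiegelReindex` condition. [cite: HarrisKudlaSweet1996, §1 (1.11)] -/
theorem blkC_eq_zero_iff (M : Matrix (ι ⊕ ι) (ι ⊕ ι) L) :
    blkC M = 0 ↔ M.toBlocks₁₁ + M.toBlocks₁₂ = M.toBlocks₂₁ + M.toBlocks₂₂ := by
  rw [← blkA_add_blkC, ← blkA_sub_blkC, sub_eq_add_neg, add_right_inj]
  constructor
  · intro h; rw [h, neg_zero]
  · intro h
    have h2 : (2 : L) • blkC M = 0 := by rw [two_smul]; nth_rw 1 [h]; exact neg_add_cancel _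
    rw [← one_smul L (blkC M), ← invOf_mul_self (2 : L), ← smul_smul, h2, smul_zero]

omit [Fintype ι] [DecidableEq ι] in
/-- on `P_Δ`, `A = M₁₁ + M₁₂`. [cite: Kudla1994, §3] -/
theorem blkA_eq_of_blkC_eq_zero {M : Matrix (ι ⊕ ι) (ι ⊕ ι) L} (h : blkC M = 0) :
    blkA M = M.toBlocks₁₁ + M.toBlocks₁₂ := by
  rw [← blkA_add_blkC, h, add_zero]

omit [DecidableEq ι] in
/-- **`M (a, a) = dblV (A a) + adblV (C a)`**: the first block column of `adapt M` is `M|_Δ`. [cite: Kudla1994, §3] -/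
theorem mulVec_dblV (M : Matrix (ι ⊕ ι) (ι ⊕ ι) L) (z : ι → L) :
    M *ᵥ dblV z = dblV (blkA M *ᵥ z) + adblV (blkC M *ᵥ z) := by
  rw [dblV_add_adblV, ← Matrix.add_mulVec, ← Matrix.sub_mulVec, blkA_add_blkC, blkA_sub_blkC]
  conv_lhs => rw [← Matrix.fromBlocks_toBlocks M, dblV]
  rw [Matrix.fromBlocks_mulVec, Sum.elim_comp_inl, Sum.elim_comp_inr, Matrix.add_mulVec, Matrix.add_mulVec]

omit [DecidableEq ι] in
/-- **`M (b, −b) = dblV (B b) + adblV (D b)`**: the second block column of `adapt M` is `M|_{Δ⁻}`. [cite: Kudla1994, §3] -/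
theorem mulVec_adblV (M : Matrix (ι ⊕ ι) (ι ⊕ ι) L) (y : ι → L) :
    M *ᵥ adblV y = dblV (blkB M *ᵥ y) + adblV (blkD M *ᵥ y) := by
  rw [dblV_add_adblV, ← Matrix.add_mulVec, ← Matrix.sub_mulVec, blkB_add_blkD, blkB_sub_blkD]
  conv_lhs => rw [← Matrix.fromBlocks_toBlocks M, adblV]
  rw [Matrix.fromBlocks_mulVec, Sum.elim_comp_inl, Sum.elim_comp_inr, Matrix.sub_mulVec, Matrix.sub_mulVec,
    Matrix.mulVec_neg, Matrix.mulVec_neg, ← sub_eq_add_neg, ← sub_eq_add_neg]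

omit [DecidableEq ι] in
/-- `M (dblV a + adblV b) = dblV (A a + B b) + adblV (C a + D b)`. [cite: Kudla1994, §3] -/
theorem mulVec_dblV_add_adblV (M : Matrix (ι ⊕ ι) (ι ⊕ ι) L) (a b : ι → L) :
    M *ᵥ (dblV a + adblV b) = dblV (blkA M *ᵥ a + blkB M *ᵥ b) + adblV (blkC M *ᵥ a + blkD M *ᵥ b) := by
  rw [Matrix.mulVec_add, mulVec_dblV, mulVec_adblV, dblV_add, adblV_add]
  abel

omit [DecidableEq ι] in
/-- `halfSum (M (dblV z)) = A z`. [cite: HarrisKudlaSweet1996, §1 (1.11)] -/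
theorem halfSum_mulVec_dblV (M : Matrix (ι ⊕ ι) (ι ⊕ ι) L) (z : ι → L) : halfSum (M *ᵥ dblV z) = blkA M *ᵥ z := by
  rw [mulVec_dblV, halfSum_dblV_add_adblV]

omit [DecidableEq ι] in
/-- `halfDiff (M (dblV z)) = C z`. [cite: HarrisKudlaSweet1996, §1 (1.11)] -/
theorem halfDiff_mulVec_dblV (M : Matrix (ι ⊕ ι) (ι ⊕ ι) L) (z : ι → L) :
    halfDiff (M *ᵥ dblV z) = blkC M *ᵥ z := by
  rw [mulVec_dblV, halfDiff_dblV_add_adblV]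

end Blocks

end Literature.NumberTheory.GelbartRogawski1991.AdaptedBlocks
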